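import Summits.Langlands.Langlands.Theorems.IrreducibilityBySelfDualityPairLBoundaryJSGlobalPairTranslateGen
import Summits.Langlands.Langlands.Theorems.IrreducibilityBySelfDualityPairLBoundaryJSGlobalPairTwistedTranslateGen
import Literature.NumberTheory.Automorphic.PairLFunctionNeConjOrthogonalLocalReduction
import Literature.NumberTheory.Automorphic.SmoothedFormCentralCharacter
import Literature.NumberTheory.Automorphic.RankinSelbergTorusPairTranslate
import Literature.NumberTheory.Automorphic.RankinSelbergTorusHolomorphy

/-!
# Crux `PairLBoundaryJS` (stmt-Langlands-13622), line `Sketch`, skeleton v24 — stub `stub_isOrtho_of_local_translate_at`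

Route `IrreducibilityBySelfDuality`; lead prover c7. Leaf `hB` of `PairLBoundaryJS_of_moeglinWaldspurger_of_isOrtho`,
POINTWISE form: for cuspidal `π ⟂ σ̄` in one `L²_cusp(GL_n)` (`0 < n`), every finite `S` and Satake families `α`,
`β` off `S`, `L^S(s, α ⊗ β)` extends to an entire function (Mœglin–Waldspurger (1989), Appendice, Cor. (i)(b) in
orthogonal form; Cogdell (2004), §4.2) — GRANTED the local Rankin–Selberg theory of a cuspidal pair in TRANSLATE
form AT EVERY POINT `s₀` (the hypothesis, stub `stub_local_pair_translate_at` of the skeleton: rank `n + 1`, ONE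
finite set of places `S₀`, one level `𝔫₀` supported on `S₀`, a torus of Whittaker shifts `τ` with last entry `1`
correcting the conductor of `ψ_K` off `S₀`, general test functions `Φ_i ≥ 0` spherical off `S₀`, constants `c_i`
and ENTIRE `Λ`, `h` with `h(s₀) ≠ 0` and `Λ(s) Σ_i c_i Ψ^τ_{S₀,i}(s) = h(s)` for `re s > 1`).

This is `IsOrthoOfLocalTranslate.stub_isOrtho_of_local_translate` (skeleton v10, lead c3; local datum with
`h = 1`) re-run pointwise: `S₀ :=` the ramified set of the pair (`finite_setOf_not_isUnramifiedAt_or`, as a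
`Finset`), `S' = S₀`, `Q = σ̄ = P'.conj`, `γ = β̄`; for each `s₀` the strip identities of the two LANDED translate
global theorems `GlobalPairTranslateGen.stub_global_pair_translate_gen` and
`GlobalPairTwistedTranslateGen.stub_global_pair_twisted_translate_gen` carry the weight
`w_s(τ) = torusWeightC n K s τ`, entire and zero-free (`differentiable_torusWeightC`, `torusWeightC_ne_zero`), so
the entire function is `G = C⁻¹ w_s(τ)⁻¹ Λ Σ_i c_i F_i`; on the strip `G = s (s - 1) h L^{S₀}` (common central
scalars; both residues vanish by orthogonality, `apply_one_eq_zero_…_of_isOrtho`, `apply_zero_eq_zero_…_of_isOrtho`,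
then `exists_entire_eq_of_entire_mul_of_apply_eq_zero` with `L := h L^{S₀}`) resp. `G = h L^{S₀}` (no common
central action, twisted theorem with `χ = ω_π ω_{σ̄}⁻¹ ≠ 1`), on `re s > 1` by
`eq_mul_partialPairL_of_eqOn_strip`; so for every `s₀` an entire `J` with `J = h L^{S₀}` on `re s > 1` and
`h(s₀) ≠ 0`, whence an entire continuation of `L^{S₀}` by whole-plane patching
(`exists_differentiable_eqOn_of_entire_quotients`, `x₀ = 1`: "division by these factors can introduce no
extraneous poles", Cogdell (2004), §4.2), and all `S` by `exists_entire_eq_partialPairL_of_ramified_datum`.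
References: Mœglin–Waldspurger (1989), Appendice, Cor. (i)(b), p. 667; Cogdell (2004), §2.3, §3.1, §4.2;
Jacquet–Piatetski-Shapiro–Shalika (1983), Thm. 2.7; Jacquet–Shalika (1981), §4; Jacquet (2009), Thm. 2.1, 2.3, 2.6.
-/

noncomputable section

-- `Summit.Langlands.Langlands.…` (summit = sub-problem name, D-0017 layout) trips `dupNamespace`
set_option linter.dupNamespace false

open scoped MatrixGroups Topology Pointwise ENNReal NNReal ComplexConjugate InnerProductSpace ContDiff
-- the place subtypes indexing `mixedSpace K` are `Fintype` classically (`NormedCommRing (mixedSpace K)`)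
open scoped Classical Matrix.Norms.Operator
open NumberField IsDedekindDomain MeasureTheory Measure Matrix Set Filter WithZero
open NumberField.mixedEmbedding
open Literature.NumberTheory.Automorphic AdelicGroupData
open Literature.NumberTheory.GaloisRepresentations (ideleGroup HeckeCharacter)
open ValuativeRel

-- the automorphic quotient carries the tree's Borel σ-algebra, not Mathlib's quotient σ-algebra
attribute [-instance] Quotient.instMeasurableSpace QuotientGroup.measurableSpace

-- the house local instances, exactly as in `RankinSelbergUnfoldingIdentity`
attribute [local instance] adelicBorel borelSpace_adelic locallyCompactSpace_adelic secondCountableTopology_gl_adelic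
  glAdeleBorel borelSpace_glAdele borelSpace_ideleGroup secondCountableTopology_ideleGroup

-- Mathlib idiom: the commutator Lie ring on matrices, to mention `(archGroupGL n K).lie`
attribute [local instance 100] LieRing.ofAssociativeRing

namespace Summit.Langlands.Langlands.Theorems.IsOrthoOfLocalTranslateAt

/-- **Registered stub `stub_isOrtho_of_local_translate_at` of the crux skeleton `PairLBoundaryJS` (line `Sketch`,
v24): the orthogonal-pair continuation (leaf hB) from the POINTWISE local translate datum and the translate global
theorems.** For cuspidal `π ⟂ σ̄` in one `L²_cusp(GL_n)` (`0 < n`), every finite `S` and Satake families `α`, `β`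
of `π`, `σ` off `S`, `L^S(s, α ⊗ β)` agrees on `re s > 1` with an entire function — granted, for every `s₀ ∈ ℂ`,
the local Rankin–Selberg theory of a cuspidal pair in translate form with entire `Λ`, `h`, `h(s₀) ≠ 0`,
`Λ Σ c_i Ψ^τ_i = h` on `re s > 1` (the hypothesis). Proof: `n = r + 1`; Borel structure and Haar measures chosen
inside; `S₀ :=` the places ramified for `π` or `σ` with the canonical Satake families `α₀`, `β₀` off `S₀`
(`exists_isSatakeFamilyOf_pair_ramified`; `σ̄` is unramified where `σ` is, `isUnramifiedAt_conj_iff`); by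
whole-plane patching (`exists_differentiable_eqOn_of_entire_quotients`, `x₀ = 1`) it suffices to produce, for each
`s₀`, entire `J`, `A` with `A(s₀) ≠ 0` and `J = A L^{S₀}` on `re s > 1`: the local datum at `(π, σ̄, S₀, s₀)`
gives `A := h`; common central scalars ↦ `GlobalPairTranslateGen.stub_global_pair_translate_gen` gives entire
`F_i = s (s - 1) C w_s(τ) L^{S₀} Ψ^τ_i` on the strip with `F_i(1) = F_i(0) = 0` (orthogonality), and
`G = C⁻¹ w_s(τ)⁻¹ Λ Σ c_i F_i` is entire (`torusWeightC_ne_zero`, `differentiable_torusWeightC`), equals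
`s (s - 1) h L^{S₀}` (`eq_mul_partialPairL_of_eqOn_strip`) and vanishes at `0`, `1`, so `J` with `J = h L^{S₀}`
exists (`exists_entire_eq_of_entire_mul_of_apply_eq_zero`); otherwise `ω_π ≠ ω_{σ̄}`
(`exists_centralCharacter_smoothedForm`), `χ = ω_π ω_{σ̄}⁻¹ ≠ 1` is trivial on `A_G` and
`GlobalPairTwistedTranslateGen.stub_global_pair_twisted_translate_gen` gives `J := G = h L^{S₀}` on the strip;
finally all `S` by `exists_entire_eq_partialPairL_of_ramified_datum`. Mœglin–Waldspurger (1989), Appendice,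
Cor. (i)(b); Cogdell (2004), §4.2 ("division by these factors can introduce no extraneous poles").
[cite: MoeglinWaldspurger1989, Appendice, Corollaire (i)(b), p. 667]
[cite: CogdellAnalyticTheory2004, §4.2 (proof of Thm. 4.2)] -/
theorem stub_isOrtho_of_local_translate_at :
    (∀ {n : ℕ} {K : Type} [Field K] [NumberField K]
      {μ : Measure (AdelicGroupData.gl (n + 1) K).automorphicQuotient} [(AdelicGroupData.gl (n + 1) K).IsAutomorphicMeasure μ]
      [MeasurableSpace (AdeleRing (𝓞 K) K)] [BorelSpace (AdeleRing (𝓞 K) K)]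
      (νA : Measure (Fin (n + 1) → ideleGroup K)) [IsHaarMeasure νA]
      (νK : Measure ↥(maximalCompactAdelic (n + 1) K)) [IsHaarMeasure νK]
      (ν₀ : Measure ↥(adelicUnipotent (n + 1) K)) [IsHaarMeasure ν₀]
      (P Q : CuspidalAutomorphicRepGL (n + 1) K μ), (P.1.toSubmodule ⟂ Q.1.toSubmodule ∨ P = Q) →
      ∀ (S₀ : Finset (HeightOneSpectrum (𝓞 K))), (∀ v ∉ S₀, IsUnramifiedAt P.1 v ∧ IsUnramifiedAt Q.1 v) →
      ∀ (s₀ : ℂ),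
      ∃ (τ : Fin (n + 1) → ideleGroup K), lastEntry τ = 1 ∧
      (∀ v ∉ S₀, ∃ (d : Fin (n + 1) → (v.adicCompletion K)ˣ) (a : (v.adicCompletion K)ˣ),
        localComponent v (glDiagonal (n + 1) (AdeleRing (𝓞 K) K) τ) = diagonalGL (Fin (n + 1)) (v.adicCompletion K) d ∧
        (∀ i j : Fin (n + 1), (i : ℕ) + 1 = j → (d i : v.adicCompletion K) * ((d j)⁻¹ : (v.adicCompletion K)ˣ) = a) ∧
        (∀ c ∈ 𝒪[v.adicCompletion K], (adeleAddChar K).adicComponent v (a * c) = 1) ∧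
        ∀ ϖ : v.adicCompletion K, Valued.v ϖ = WithZero.exp (-1 : ℤ) →
          ∃ c ∈ 𝒪[v.adicCompletion K], (adeleAddChar K).adicComponent v (a * (ϖ⁻¹ * c)) ≠ 1) ∧
      ∃ (k : ℕ) (c : Fin k → ℂ) (f : Fin k → P.1.toSubmodule) (f' : Fin k → Q.1.toSubmodule) (𝔫₀ : Ideal (𝓞 K)),
      𝔫₀ ≠ 0 ∧ (∀ w : HeightOneSpectrum (𝓞 K), w.asIdeal ∣ 𝔫₀ → w ∈ S₀) ∧
      ∃ (η : Fin k → (AdelicGroupData.gl (n + 1) K).Adelic → ℝ), (∀ i, IsTestFunctionGL (n + 1) K (η i)) ∧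
      (∀ i, ∀ u : (AdelicGroupData.gl (n + 1) K).Adelic, u ∈ principalCongruenceLevel (n + 1) K 𝔫₀ → ∀ g : (AdelicGroupData.gl (n + 1) K).Adelic, η i (u * g) = η i g) ∧
      ∃ (Φ : Fin k → (Fin (n + 1) → AdeleRing (𝓞 K) K) → ℝ), (∀ i, Continuous (Φ i)) ∧ (∀ i y, 0 ≤ Φ i y) ∧
      (∀ i, (fun y => ((Φ i y : ℝ) : ℂ)) ∈ piSchwartzBruhat K (Fin (n + 1))) ∧
      (∀ i, ∀ v ∉ S₀, IsLastRowSphericalAt (n + 1) K (Φ i) v) ∧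
      (∀ i, ∀ v ∉ S₀, ∀ y : Fin (n + 1) → AdeleRing (𝓞 K) K, Φ i y ≠ 0 → ∀ j, Valued.v ((y j).2 v) ≤ 1) ∧
      ∃ Λ h : ℂ → ℂ, Differentiable ℂ Λ ∧ Differentiable ℂ h ∧ h s₀ ≠ 0 ∧ ∀ s : ℂ, 1 < s.re →
      Λ s * ∑ i, c i * ∫ p in unitBox {v | v ∉ (↑S₀ : Set (HeightOneSpectrum (𝓞 K)))} ×ˢ Set.univ,
        torusPairIntegrandC (n + 1) K
          (fun g => whittakerCoeff ν₀ (unipotentTateDomain (n + 1) K) (adeleAddChar K) (invQuot (AdelicGroupData.gl (n + 1) K) (smoothedForm (η i) ((f i : P.1.toSubmodule) : (AdelicGroupData.gl (n + 1) K).L2 μ))) (glDiagonal (n + 1) (AdeleRing (𝓞 K) K) τ * g))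
          (fun g => star (whittakerCoeff ν₀ (unipotentTateDomain (n + 1) K) (adeleAddChar K) (invQuot (AdelicGroupData.gl (n + 1) K) (smoothedForm (η i) ((f' i : Q.1.toSubmodule) : (AdelicGroupData.gl (n + 1) K).L2 μ)))) (glDiagonal (n + 1) (AdeleRing (𝓞 K) K) τ * g))
          (Φ i) s p ∂(νA.prod νK) = h s) →
    ∀ {n : ℕ} {K : Type} [Field K] [NumberField K]
      {μ : Measure (AdelicGroupData.gl n K).automorphicQuotient} [(AdelicGroupData.gl n K).IsAutomorphicMeasure μ]
      (_hn : 0 < n) (P P' : CuspidalAutomorphicRepGL n K μ) (_hor : P.1.toSubmodule ⟂ P'.conj.1.toSubmodule)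
      {S : Set (HeightOneSpectrum (𝓞 K))} (_hS : S.Finite) {α β : SatakeFamily K}
      (_hα : IsSatakeFamilyOf P S α) (_hβ : IsSatakeFamilyOf P' S β),
      ∃ g : ℂ → ℂ, Differentiable ℂ g ∧ ∀ s : ℂ, 1 < s.re → g s = partialPairL S α β s := by
  intro hloc n K _ _ μ' _ hn P P' hor S hS α β hα hβ
  classical
  -- the rank is positive: `n = r + 1`
  obtain ⟨r, rfl⟩ : ∃ r, n = r + 1 := ⟨n - 1, by omega⟩
  -- topological and measurable structures (verbatim `IsOrthoOfLocalTranslate.stub_isOrtho_of_local_translate`)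
  haveI : T2Space (GL (Fin (r + 1)) (AdeleRing (𝓞 K) K)) := t2Space_gl (r + 1) K
  haveI : LocallyCompactSpace (GL (Fin (r + 1)) (AdeleRing (𝓞 K) K)) :=
    AdelicGroupData.locallyCompactSpace_generalLinearGroup_adeleRing K (Fin (r + 1))
  haveI := secondCountableTopology_generalLinearGroup_adeleRing K (Fin (r + 1))
  haveI : T2Space (AdeleRing (𝓞 K) K) := t2Space_adeleRing K
  letI : MeasurableSpace (AdeleRing (𝓞 K) K) := borel _; haveI : BorelSpace (AdeleRing (𝓞 K) K) := ⟨rfl⟩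
  haveI := borelSpace_ideleGroup K; haveI := locallyCompactSpace_ideleGroup K
  haveI := secondCountableTopology_ideleGroup K; haveI := secondCountableTopology_adeleRing K
  haveI := locallyCompactSpace_adeleRing' K
  haveI : CompactSpace ↥(maximalCompactAdelic (r + 1) K) :=
    isCompact_iff_compactSpace.1 (isCompact_maximalCompactAdelic (r + 1) K)
  haveI : LocallyCompactSpace ↥(adelicUnipotent (r + 1) K) := (isClosed_adelicUnipotent (r + 1) K).locallyCompactSpace
  -- Haar measures (`ν_I` from `exists_isHaarMeasure_ideleGroup`, the others `Measure.haar`)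
  obtain ⟨νI, hνI⟩ := exists_isHaarMeasure_ideleGroup K
  obtain ⟨νA, hνA⟩ : ∃ ν : Measure (Fin (r + 1) → ideleGroup K), IsHaarMeasure ν := ⟨Measure.haar, inferInstance⟩
  obtain ⟨νK, hνK⟩ : ∃ ν : Measure ↥(maximalCompactAdelic (r + 1) K), IsHaarMeasure ν := ⟨Measure.haar, inferInstance⟩
  obtain ⟨ν₀, hν₀⟩ : ∃ ν : Measure ↥(adelicUnipotent (r + 1) K), IsHaarMeasure ν := ⟨Measure.haar, inferInstance⟩
  -- the ramified set `S₀` of the pair (a `Finset`) and the canonical Satake families off it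
  obtain ⟨α₀, β₀, hα₀', hβ₀'⟩ := exists_isSatakeFamilyOf_pair_ramified P P'
  have hS₀f : {v : HeightOneSpectrum (𝓞 K) | ¬ IsUnramifiedAt P.1 v ∨ ¬ IsUnramifiedAt P'.1 v}.Finite :=
    finite_setOf_not_isUnramifiedAt_or P P'
  obtain ⟨S₀, hcoe⟩ : ∃ S₀ : Finset (HeightOneSpectrum (𝓞 K)),
      (↑S₀ : Set (HeightOneSpectrum (𝓞 K))) = {v | ¬ IsUnramifiedAt P.1 v ∨ ¬ IsUnramifiedAt P'.1 v} :=
    ⟨hS₀f.toFinset, hS₀f.coe_toFinset⟩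
  have hmemS₀ : ∀ v : HeightOneSpectrum (𝓞 K), v ∈ S₀ ↔ ¬ IsUnramifiedAt P.1 v ∨ ¬ IsUnramifiedAt P'.1 v :=
    fun v => by rw [← Finset.mem_coe, hcoe, Set.mem_setOf_eq]
  have hα₀ : IsSatakeFamilyOf P (↑S₀ : Set (HeightOneSpectrum (𝓞 K))) α₀ := hα₀'.mono hcoe.symm.subset
  have hβ₀ : IsSatakeFamilyOf P' (↑S₀ : Set (HeightOneSpectrum (𝓞 K))) β₀ := hβ₀'.mono hcoe.symm.subset
  have hram : ∀ v ∈ (↑S₀ : Set (HeightOneSpectrum (𝓞 K))), ¬ IsUnramifiedAt P.1 v ∨ ¬ IsUnramifiedAt P'.1 v :=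
    fun v hv => (hmemS₀ v).1 (Finset.mem_coe.1 hv)
  refine exists_entire_eq_partialPairL_of_ramified_datum P P' hram hα₀ hβ₀ ?_ hS hα hβ
  -- whole-plane patching: it suffices to control `L^{S₀}` by an entire quotient at every point `s₀`
  refine exists_differentiable_eqOn_of_entire_quotients (x₀ := 1)
    (L := partialPairL (↑S₀ : Set (HeightOneSpectrum (𝓞 K))) α₀ β₀) fun s₀ => ?_
  -- `π` and `σ̄` are unramified off `S₀`
  have hU : ∀ v ∉ S₀, IsUnramifiedAt P.1 v ∧ IsUnramifiedAt P'.conj.1 v := fun v hv =>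
    ⟨of_not_not fun h => hv ((hmemS₀ v).2 (Or.inl h)),
      isUnramifiedAt_conj_iff.2 (of_not_not fun h => hv ((hmemS₀ v).2 (Or.inr h)))⟩
  -- the local datum at `(π, σ̄, S₀)` and the point `s₀`
  obtain ⟨τ, hτ, hτψ, k, c, f, f', 𝔫₀, h𝔫₀, h𝔫₀S, η, hη, hηK, Φ, hΦc, hΦ0, hΦS, hΦsph, hΦv, Λ, A, hΛ, hA, hA0,
      hΛsum⟩ := hloc νA νK ν₀ P P'.conj (Or.inl hor) S₀ hU s₀
  -- `S₀` carries the level; enumerations of the Satake parameters of `π`, `σ̄` off `S₀`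
  have hS' : ∀ v ∉ (↑S₀ : Set (HeightOneSpectrum (𝓞 K))), ¬ v.asIdeal ∣ 𝔫₀ := fun v hv h =>
    hv (Finset.mem_coe.2 (h𝔫₀S v h))
  have hexx : ∀ v : HeightOneSpectrum (𝓞 K), ∃ x : Fin (r + 1) → ℂ, v ∉ (↑S₀ : Set (HeightOneSpectrum (𝓞 K))) →
      (Finset.univ : Finset (Fin (r + 1))).val.map x = α₀ v := by
    intro v
    by_cases hv : v ∉ (↑S₀ : Set (HeightOneSpectrum (𝓞 K)))
    · obtain ⟨x, hx⟩ := exists_univ_val_map_eq (hα₀.card_eq hv)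
      exact ⟨x, fun _ => hx⟩
    · exact ⟨fun _ => 0, fun h => absurd h hv⟩
  have hexy : ∀ v : HeightOneSpectrum (𝓞 K), ∃ y : Fin (r + 1) → ℂ, v ∉ (↑S₀ : Set (HeightOneSpectrum (𝓞 K))) →
      (Finset.univ : Finset (Fin (r + 1))).val.map y = (β₀ v).map conj := by
    intro v
    by_cases hv : v ∉ (↑S₀ : Set (HeightOneSpectrum (𝓞 K)))
    · obtain ⟨y, hy⟩ := exists_univ_val_map_eq (R := ℂ) (m := r + 1) (α := (β₀ v).map conj)
        (by rw [Multiset.card_map]; exact hβ₀.card_eq hv)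
      exact ⟨y, fun _ => hy⟩
    · exact ⟨fun _ => 0, fun h => absurd h hv⟩
  choose x hx using hexx
  choose y hy using hexy
  have hββ : (fun v => ((β₀ v).map conj).map conj) = β₀ := funext fun v => multiset_map_conj_map_conj _
  -- the weight `w_s(τ)` is entire and zero-free
  have htw : Differentiable ℂ fun s => (torusWeightC (r + 1) K s τ)⁻¹ :=
    (differentiable_torusWeightC τ).inv fun s => torusWeightC_ne_zero s τ
  by_cases hcen : (∀ z : ideleGroup K, ∃ c : ℂ, ‖c‖ = 1 ∧
      (∀ f : P.1.toSubmodule,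
        (AdelicGroupData.gl (r + 1) K).rightRegular μ' (Matrix.GeneralLinearGroup.scalar (Fin (r + 1)) z)
            (f : (AdelicGroupData.gl (r + 1) K).L2 μ') = c • (f : (AdelicGroupData.gl (r + 1) K).L2 μ')) ∧
      (∀ f' : P'.conj.1.toSubmodule,
        (AdelicGroupData.gl (r + 1) K).rightRegular μ' (Matrix.GeneralLinearGroup.scalar (Fin (r + 1)) z)
            (f' : (AdelicGroupData.gl (r + 1) K).L2 μ') = c • (f' : (AdelicGroupData.gl (r + 1) K).L2 μ')))
  · /- a common central action: the untwisted translate global theorem, residues at `1` and `0` -/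
    obtain ⟨C, hC, hT⟩ := GlobalPairTranslateGen.stub_global_pair_translate_gen hn μ' νI νA νK ν₀
    have hZ : ∀ (i : Fin k) (z : ideleGroup K), ∃ c : ℂ, ‖c‖ = 1 ∧
        (AdelicGroupData.gl (r + 1) K).rightRegular μ' (Matrix.GeneralLinearGroup.scalar (Fin (r + 1)) z)
            ((f i : P.1.toSubmodule) : (AdelicGroupData.gl (r + 1) K).L2 μ') =
          c • ((f i : P.1.toSubmodule) : (AdelicGroupData.gl (r + 1) K).L2 μ') ∧
        (AdelicGroupData.gl (r + 1) K).rightRegular μ' (Matrix.GeneralLinearGroup.scalar (Fin (r + 1)) z)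
            ((f' i : P'.conj.1.toSubmodule) : (AdelicGroupData.gl (r + 1) K).L2 μ') =
          c • ((f' i : P'.conj.1.toSubmodule) : (AdelicGroupData.gl (r + 1) K).L2 μ') := fun i z => by
      obtain ⟨d, hd, hP, hQ⟩ := hcen z
      exact ⟨d, hd, hP (f i), hQ (f' i)⟩
    choose F hF hFI hFstrip using fun i : Fin k =>
      hT P P'.conj (f i) (f' i) (hZ i) hα₀ hβ₀.conj h𝔫₀ (hη i) (hηK i) Set.Subset.rfl hS' τ hτ
        (fun v hv => hτψ v fun h => hv (Finset.mem_coe.2 h)) hx hy (hΦc i) (hΦ0 i) (hΦS i)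
        (fun v hv => hΦsph i v fun h => hv (Finset.mem_coe.2 h))
        (fun v hv => hΦv i v fun h => hv (Finset.mem_coe.2 h))
    -- the residues of every `F_i` at `s = 1` and `s = 0` vanish by orthogonality
    have hF1' : ∀ i, F i 1 = 0 := fun i =>
      apply_one_eq_zero_of_entire_eq_mul_rankinSelbergIntegral_of_isOrtho hn νI P P'.conj hor.symm (f i) (f' i)
        (hη i) (hΦS i) (hF i) (hFI i)
    have hF0' : ∀ i, F i 0 = 0 := fun i =>
      apply_zero_eq_zero_of_entire_eq_mul_rankinSelbergIntegral_of_isOrtho hn νI P P'.conj hor.symm (f i) (f' i)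
        (hη i) (hΦS i) (hF i) (hFI i)
    -- `∑ c_i F_i = s (s - 1) · C · w_s(τ) · L^{S₀} · ∑ c_i Ψ^τ_i` on the strip
    have hsum : ∀ s : ℂ, 1 < s.re → s.re < 2 → ∑ i, c i * F i s =
        (s * (s - 1) * (C : ℂ) * torusWeightC (r + 1) K s τ *
            partialPairL (↑S₀ : Set (HeightOneSpectrum (𝓞 K))) α₀ β₀ s) *
          ∑ i, c i * ∫ p in unitBox {v | v ∉ (↑S₀ : Set (HeightOneSpectrum (𝓞 K)))} ×ˢ Set.univ,
            torusPairIntegrandC (r + 1) K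
              (fun g => whittakerCoeff ν₀ (unipotentTateDomain (r + 1) K) (adeleAddChar K) (invQuot (AdelicGroupData.gl (r + 1) K) (smoothedForm (η i) ((f i : P.1.toSubmodule) : (AdelicGroupData.gl (r + 1) K).L2 μ'))) (glDiagonal (r + 1) (AdeleRing (𝓞 K) K) τ * g))
              (fun g => star (whittakerCoeff ν₀ (unipotentTateDomain (r + 1) K) (adeleAddChar K) (invQuot (AdelicGroupData.gl (r + 1) K) (smoothedForm (η i) ((f' i : P'.conj.1.toSubmodule) : (AdelicGroupData.gl (r + 1) K).L2 μ')))) (glDiagonal (r + 1) (AdeleRing (𝓞 K) K) τ * g))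
              (Φ i) s p ∂(νA.prod νK) := by
      intro s hs1 hs2
      rw [Finset.mul_sum]
      refine Finset.sum_congr rfl fun i _ => ?_
      have h := hFstrip i s hs1 hs2
      beta_reduce at h
      rw [hββ] at h
      rw [h]
      ring
    -- the entire function `G = C⁻¹ w(τ)⁻¹ Λ ∑ c_i F_i`
    have hC0 : (C : ℂ) ≠ 0 := Complex.ofReal_ne_zero.2 hC.ne'
    have hsumF : Differentiable ℂ fun s => ∑ i, c i * F i s := by
      have h : Differentiable ℂ (∑ i, fun s => c i * F i s) := Differentiable.sum fun i _ => (hF i).const_mul (c i)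
      convert h using 1
      funext s
      simp only [Finset.sum_apply]
    have hG : Differentiable ℂ fun s => (C : ℂ)⁻¹ * ((torusWeightC (r + 1) K s τ)⁻¹ * (Λ s * ∑ i, c i * F i s)) :=
      (htw.mul (hΛ.mul hsumF)).const_mul _
    -- on the strip `G = s (s - 1) h L^{S₀}` (`Λ ∑ c_i Ψ^τ_i = h`)
    have hGstrip : ∀ s : ℂ, 1 < s.re → s.re < 2 →
        (C : ℂ)⁻¹ * ((torusWeightC (r + 1) K s τ)⁻¹ * (Λ s * ∑ i, c i * F i s)) =
          s * (s - 1) * A s * partialPairL (↑S₀ : Set (HeightOneSpectrum (𝓞 K))) α₀ β₀ s := by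
      intro s hs1 hs2
      have h1 := hΛsum s hs1
      have htw0 := torusWeightC_ne_zero (n := r + 1) (K := K) s τ
      rw [hsum s hs1 hs2, mul_left_comm (Λ s), h1]
      field_simp
    have hA2 : Differentiable ℂ fun z : ℂ => z * (z - 1) * A z := by fun_prop
    have hGL : ∀ s : ℂ, 1 < s.re →
        (C : ℂ)⁻¹ * ((torusWeightC (r + 1) K s τ)⁻¹ * (Λ s * ∑ i, c i * F i s)) =
          s * (s - 1) * A s * partialPairL (↑S₀ : Set (HeightOneSpectrum (𝓞 K))) α₀ β₀ s :=
      eq_mul_partialPairL_of_eqOn_strip P P' hα₀ hβ₀ hG hA2 hGstrip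
    have hGL' : ∀ s : ℂ, 1 < s.re →
        (C : ℂ)⁻¹ * ((torusWeightC (r + 1) K s τ)⁻¹ * (Λ s * ∑ i, c i * F i s)) =
          s * (s - 1) * (A s * partialPairL (↑S₀ : Set (HeightOneSpectrum (𝓞 K))) α₀ β₀ s) := fun s hs => by
      rw [hGL s hs]; ring
    have hG1 : (C : ℂ)⁻¹ * ((torusWeightC (r + 1) K 1 τ)⁻¹ * (Λ 1 * ∑ i, c i * F i 1)) = 0 := by
      rw [Finset.sum_eq_zero fun i _ => by rw [hF1' i, mul_zero], mul_zero, mul_zero, mul_zero]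
    have hG0 : (C : ℂ)⁻¹ * ((torusWeightC (r + 1) K 0 τ)⁻¹ * (Λ 0 * ∑ i, c i * F i 0)) = 0 := by
      rw [Finset.sum_eq_zero fun i _ => by rw [hF0' i, mul_zero], mul_zero, mul_zero, mul_zero]
    -- `G` vanishes at `0`, `1`: an entire `J` with `J = h L^{S₀}` on `re s > 1`
    obtain ⟨J, hJ, hJL⟩ := exists_entire_eq_of_entire_mul_of_apply_eq_zero
      (L := fun s => A s * partialPairL (↑S₀ : Set (HeightOneSpectrum (𝓞 K))) α₀ β₀ s) hG hG0 hG1 hGL'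
    exact ⟨J, A, hJ, hA, hA0, hJL⟩
  · /- no common central action: the twisted translate global theorem -/
    -- the central characters of `π` and `σ̄` differ
    obtain ⟨ω₁, hω₁u, hω₁A, hω₁act, hω₁S, -, -⟩ := P.exists_centralCharacter_smoothedForm
    obtain ⟨ω₂, hω₂u, hω₂A, hω₂act, hω₂S, -, -⟩ := P'.conj.exists_centralCharacter_smoothedForm
    have hωne : ω₁ ≠ ω₂ := by
      intro hωeq
      refine hcen fun z => ⟨((ω₁ z : ℂˣ) : ℂ), hω₁u z, fun g => ?_, fun g' => ?_⟩
      · have h := congrArg Subtype.val (hω₁act z g)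
        rw [ContRepresentation.ClosedSubrep.coe_toContRep_apply, Submodule.coe_smul] at h
        exact h
      · have h := congrArg Subtype.val (hω₂act z g')
        rw [ContRepresentation.ClosedSubrep.coe_toContRep_apply, Submodule.coe_smul, ← hωeq] at h
        exact h
    set χ : HeckeCharacter K := ω₁ * ω₂⁻¹ with hχ
    have hχ1 : χ ≠ 1 := by
      intro h
      apply hωne
      have h' := congrArg (· * ω₂) h
      simpa only [hχ, inv_mul_cancel_right, one_mul] using h'
    have hχ₀ : ∀ t : ℝ≥0ˣ, χ (posRealIdele K t) = 1 := fun t => by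
      rw [hχ, HeckeCharacter.mul_apply, HeckeCharacter.inv_apply, hω₁A t, hω₂A t, inv_one, mul_one]
    -- the twisted translate global theorem
    obtain ⟨C, hC, hT⟩ := GlobalPairTwistedTranslateGen.stub_global_pair_twisted_translate_gen hn μ' νI νA νK ν₀
    choose F hF hFI hFstrip using fun i : Fin k =>
      hT P P'.conj (f i) (f' i) hω₁u hω₂u hχ hχ1 hχ₀ hα₀ hβ₀.conj h𝔫₀ (hη i) (hηK i)
        (fun z g => hω₁S (η i) (f i) z g) (fun z g => hω₂S (η i) (f' i) z g) Set.Subset.rfl hS' τ hτ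
        (fun v hv => hτψ v fun h => hv (Finset.mem_coe.2 h)) hx hy (hΦc i) (hΦ0 i) (hΦS i)
        (fun v hv => hΦsph i v fun h => hv (Finset.mem_coe.2 h))
        (fun v hv => hΦv i v fun h => hv (Finset.mem_coe.2 h))
    -- `∑ c_i F_i = C · w_s(τ) · L^{S₀} · ∑ c_i Ψ^τ_i` on the strip
    have hsum : ∀ s : ℂ, 1 < s.re → s.re < 2 → ∑ i, c i * F i s =
        ((C : ℂ) * torusWeightC (r + 1) K s τ * partialPairL (↑S₀ : Set (HeightOneSpectrum (𝓞 K))) α₀ β₀ s) *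
          ∑ i, c i * ∫ p in unitBox {v | v ∉ (↑S₀ : Set (HeightOneSpectrum (𝓞 K)))} ×ˢ Set.univ,
            torusPairIntegrandC (r + 1) K
              (fun g => whittakerCoeff ν₀ (unipotentTateDomain (r + 1) K) (adeleAddChar K) (invQuot (AdelicGroupData.gl (r + 1) K) (smoothedForm (η i) ((f i : P.1.toSubmodule) : (AdelicGroupData.gl (r + 1) K).L2 μ'))) (glDiagonal (r + 1) (AdeleRing (𝓞 K) K) τ * g))
              (fun g => star (whittakerCoeff ν₀ (unipotentTateDomain (r + 1) K) (adeleAddChar K) (invQuot (AdelicGroupData.gl (r + 1) K) (smoothedForm (η i) ((f' i : P'.conj.1.toSubmodule) : (AdelicGroupData.gl (r + 1) K).L2 μ')))) (glDiagonal (r + 1) (AdeleRing (𝓞 K) K) τ * g))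
              (Φ i) s p ∂(νA.prod νK) := by
      intro s hs1 hs2
      rw [Finset.mul_sum]
      refine Finset.sum_congr rfl fun i _ => ?_
      have h := hFstrip i s hs1 hs2
      beta_reduce at h
      rw [hββ] at h
      rw [h]
      ring
    -- the entire function `G = C⁻¹ w(τ)⁻¹ Λ ∑ c_i F_i` equals `h L^{S₀}` on the strip
    have hC0 : (C : ℂ) ≠ 0 := Complex.ofReal_ne_zero.2 hC.ne'
    have hsumF : Differentiable ℂ fun s => ∑ i, c i * F i s := by
      have h : Differentiable ℂ (∑ i, fun s => c i * F i s) := Differentiable.sum fun i _ => (hF i).const_mul (c i)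
      convert h using 1
      funext s
      simp only [Finset.sum_apply]
    have hG : Differentiable ℂ fun s => (C : ℂ)⁻¹ * ((torusWeightC (r + 1) K s τ)⁻¹ * (Λ s * ∑ i, c i * F i s)) :=
      (htw.mul (hΛ.mul hsumF)).const_mul _
    have hGstrip : ∀ s : ℂ, 1 < s.re → s.re < 2 →
        (C : ℂ)⁻¹ * ((torusWeightC (r + 1) K s τ)⁻¹ * (Λ s * ∑ i, c i * F i s)) =
          A s * partialPairL (↑S₀ : Set (HeightOneSpectrum (𝓞 K))) α₀ β₀ s := by
      intro s hs1 hs2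
      have h1 := hΛsum s hs1
      have htw0 := torusWeightC_ne_zero (n := r + 1) (K := K) s τ
      rw [hsum s hs1 hs2, mul_left_comm (Λ s), h1]
      field_simp
    have hGL : ∀ s : ℂ, 1 < s.re →
        (C : ℂ)⁻¹ * ((torusWeightC (r + 1) K s τ)⁻¹ * (Λ s * ∑ i, c i * F i s)) =
          A s * partialPairL (↑S₀ : Set (HeightOneSpectrum (𝓞 K))) α₀ β₀ s :=
      eq_mul_partialPairL_of_eqOn_strip P P' hα₀ hβ₀ hG hA hGstrip
    exact ⟨_, A, hG, hA, hA0, hGL⟩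

end Summit.Langlands.Langlands.Theorems.IsOrthoOfLocalTranslateAt

end
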